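import Summits.Ventures.HSemireg.EmbeddedFirstOrderDeformationsCechMinusTwoCurve

/-!
# Venture HSemireg — a trivial deformation direction carries no obstruction: if the transition derivations `θ_αβ`
# are a Čech COBOUNDARY of chart vector fields then every `Z` lifts; hence the directions `ξ` of the two witnesses
# are NON-ZERO in `Ȟ¹(T_X)` (Hartshorne, *Deformation Theory*, §5 Ex. 5.2 / §6 Thm. 6.2 (b): `ob_Z(ξ) ≠ 0 ⇒ ξ ≠ 0`)

HONEST FRAMING.  Lean side of the computation cell `pub-hsemireg` (track «S4-PUSH» (ii), seat s4-prove-3 g6, second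
route for (S5)); log `s4push/prove-3/ATTEMPT-10.md` §5e.  Plain commutative algebra over the twisted dual-number
atlases of `…TwistedAtlas`; no Mathlib scheme, sheaf, abelian variety or semiregularity map; nothing here says that
HC, HC_CM or HC_AV holds; no object is certified; no Literature fact is declared.

WHAT (namespace `Summit.Ventures.HSemireg.EmbeddedDeformation`):
* **`exists_isAtlasLift_twisted_of_ksCoboundary`** (general, for the atlas of `thickenedAtlas_twisted`): if there
  are derivations `D_α` of the charts `A_α`, extending along the restrictions to derivations `Eˡ_αβ`, `Eʳ_αβ` of
  the overlaps (`rˡ ∘ D_α = Eˡ_αβ ∘ rˡ`, `rʳ ∘ D_β = Eʳ_αβ ∘ rʳ`), with `Eˡ_αβ = Eʳ_αβ + θ_αβ` — i.e. the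
  Kodaira–Spencer cocycle `(θ_αβ)` is the Čech COBOUNDARY of the vector fields `(D_α)` — then EVERY subscheme
  `Z = (I_α)` lifts to `X_ξ`: `K_α := (id + εD_α)(I_α·A_α[ε])` is a compatible family of flat lifts (the twists
  commute with base change, `…BaseChange.mapRingHom_comp_twist`, and add, `…Cocycle.twist_add`).  This is the
  converse sanity statement to the witnesses: a trivial direction `ξ = 0` obstructs nothing.
* **`thetaFamily_not_ksCoboundary_doubledLine`** / **`thetaFamily_not_ksCoboundary_minusTwo`** — contrapositives
  with `…CechNonzeroClass` / `…CechMinusTwoCurve`: the shear `s⁻¹∂/∂p` of the doubled plane, resp. the smoothing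
  direction of the `A₁`-singularity on `𝒪_{ℙ¹}(−2)`, is NOT a coboundary `E₀ − E₁` of chart vector fields
  restricted to the overlap — the deformation directions of the two witnesses are themselves non-trivial
  (`ξ ≠ 0`), as they must be since `ob_Z(ξ) ≠ 0`; and `exists_isAtlasLift_minusTwo_untwisted` — with `θ = 0` the
  zero section of the `(−2)`-bundle atlas DOES lift (the positive companion, as in `…CechNonzeroClass`).

References: R. Hartshorne, *Deformation Theory*, GTM 257 (2010), §5 (infinitesimal deformations of `X` and
`H¹(X, T_X)`), §6 Thm. 6.2 (b) [corpus: book:springernd-deformation-theory p0054].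
-/

namespace Summit.Ventures.HSemireg

namespace EmbeddedDeformation

open DualNumber TrivSqZeroExt

universe w u

/-! ### §1 A Kodaira–Spencer coboundary obstructs nothing -/

section Twisted

variable {ι : Type w} {A : ι → Type u} [∀ α, CommRing (A α)] {A₂ : ι → ι → Type u} [∀ α β, CommRing (A₂ α β)]
variable (rl : ∀ α β, A α →+* A₂ α β) (rr : ∀ α β, A β →+* A₂ α β)
variable (I : ∀ α, Ideal (A α)) (I₂ : ∀ α β, Ideal (A₂ α β)) (θ : ∀ α β, Derivation ℤ (A₂ α β) (A₂ α β))

/-- **If `(θ_αβ)` is the coboundary of chart vector fields `(D_α)`, every `Z` lifts to `X_ξ`.**  With `D_α`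
extending to `Eˡ_αβ` along `rˡ_αβ` and `D_β` to `Eʳ_αβ` along `rʳ_αβ`, and `Eˡ_αβ = Eʳ_αβ + θ_αβ`, the ideals
`K_α := (id + εD_α)(I_α·A_α[ε])` are flat lifts (`…Restriction.IsLift.map_ringEquiv`) and agree on the overlaps:
`K_α·A_αβ[ε] = (id + εEˡ)(I_αβ·A_αβ[ε])` and `ψ_αβ(K_β·A_αβ[ε]) = (id + εθ)(id + εEʳ)(I_αβ·A_αβ[ε])`, equal by
`twist_add`. [cite: Hartshorne2010, §5 Ex. 5.2 / §6 Thm. 6.2] -/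
theorem exists_isAtlasLift_twisted_of_ksCoboundary
    (Pl : ∀ α β, PreservesLifts (fstRingHom (A α)) (ε : (A α)[ε]) (fstRingHom (A₂ α β)) (ε : (A₂ α β)[ε])
      (mapRingHom (rl α β)) (I α) (I₂ α β))
    (Pr : ∀ α β, PreservesLifts (fstRingHom (A β)) (ε : (A β)[ε]) (fstRingHom (A₂ α β)) (ε : (A₂ α β)[ε])
      (mapRingHom (rr α β)) (I β) (I₂ α β))
    (D : ∀ α, Derivation ℤ (A α) (A α)) (El Er : ∀ α β, Derivation ℤ (A₂ α β) (A₂ α β))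
    (hl : ∀ α β a, rl α β (D α a) = El α β (rl α β a)) (hr : ∀ α β a, rr α β (D β a) = Er α β (rr α β a))
    (hθ : ∀ α β, El α β = Er α β + θ α β) :
    ∃ K : ∀ α, Ideal (A α)[ε], IsAtlasLift (fun α ↦ fstRingHom (A α)) (fun α ↦ (ε : (A α)[ε]))
      (fun α β ↦ mapRingHom (rl α β))
      (fun α β ↦ (twist (θ α β) : (A₂ α β)[ε] →+* (A₂ α β)[ε]).comp (mapRingHom (rr α β))) I K := by
  -- the trivial local lifts and their twists by `D_α`
  have h0 : ∀ α, IsLift (fstRingHom (A α)) (ε : (A α)[ε]) (I α) ((I α).map (algebraMap (A α) (A α)[ε])) :=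
    fun α ↦ isLift_map_section (isFirstOrderThickening_dualNumber (A α)) _ fstRingHom_algebraMap (I α)
  refine ⟨fun α ↦ ((I α).map (algebraMap (A α) (A α)[ε])).map (twist (D α) : (A α)[ε] →+* (A α)[ε]),
    fun α ↦ (h0 α).map_ringEquiv (twist (D α))
      (fun z ↦ by rw [fstRingHom_apply, fstRingHom_apply, fst_twist]) (twist_eps _), fun α β ↦ ?_⟩
  have e1 : (I α).map (rl α β) = I₂ α β := (Pl α β).map_eq (isThickeningHom_mapRingHom (rl α β)) (h0 α)
  have e2 : (I β).map (rr α β) = I₂ α β := (Pr α β).map_eq (isThickeningHom_mapRingHom (rr α β)) (h0 β)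
  have c3 : (twist (θ α β) : (A₂ α β)[ε] →+* (A₂ α β)[ε]).comp (twist (Er α β) : (A₂ α β)[ε] →+* (A₂ α β)[ε]) =
      (twist (El α β) : (A₂ α β)[ε] →+* (A₂ α β)[ε]) := by
    rw [hθ α β, twist_add, RingEquiv.coe_ringHom_trans]
  have lhs : (((I α).map (algebraMap (A α) (A α)[ε])).map (twist (D α) : (A α)[ε] →+* (A α)[ε])).map
      (mapRingHom (rl α β)) =
      ((I₂ α β).map (algebraMap (A₂ α β) (A₂ α β)[ε])).map (twist (El α β) : (A₂ α β)[ε] →+* (A₂ α β)[ε]) := by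
    rw [Ideal.map_map, mapRingHom_comp_twist (D α) (El α β) (hl α β), ← Ideal.map_map,
      map_mapRingHom_map_algebraMap, e1]
  have rhs : (((I β).map (algebraMap (A β) (A β)[ε])).map (twist (D β) : (A β)[ε] →+* (A β)[ε])).map
      ((twist (θ α β) : (A₂ α β)[ε] →+* (A₂ α β)[ε]).comp (mapRingHom (rr α β))) =
      ((I₂ α β).map (algebraMap (A₂ α β) (A₂ α β)[ε])).map (twist (El α β) : (A₂ α β)[ε] →+* (A₂ α β)[ε]) := by
    rw [Ideal.map_map, RingHom.comp_assoc, mapRingHom_comp_twist (D β) (Er α β) (hr α β), ← RingHom.comp_assoc,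
      c3, ← Ideal.map_map, map_mapRingHom_map_algebraMap, e2]
  show (((I α).map (algebraMap (A α) (A α)[ε])).map (twist (D α) : (A α)[ε] →+* (A α)[ε])).map
      (mapRingHom (rl α β)) =
    (((I β).map (algebraMap (A β) (A β)[ε])).map (twist (D β) : (A β)[ε] →+* (A β)[ε])).map
      ((twist (θ α β) : (A₂ α β)[ε] →+* (A₂ α β)[ε]).comp (mapRingHom (rr α β)))
  rw [lhs, rhs]

end Twisted

/-! ### §2 The directions of the two witnesses are non-trivial -/

namespace DoubledLine

open MvPolynomial

variable (k : Type u) [CommRing k] [Nontrivial k]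

/-- **The shear `s⁻¹∂/∂p` of the doubled plane is NOT a Kodaira–Spencer coboundary**: there are no chart vector
fields `D₀, D₁` on `k[s,p]`, extending to `E₀, E₁` on `k[s,s⁻¹,p]`, with `E_α = E_β + θ_αβ` — else `Z = V(p)` would
lift (`exists_isAtlasLift_twisted_of_ksCoboundary`), contradicting `not_exists_isAtlasLift_doubledLine`.
[cite: Hartshorne2010, §5 Ex. 5.2 / §6 Thm. 6.2 (b)] -/
theorem thetaFamily_not_ksCoboundary_doubledLine :
    ¬ ∃ (D : Fin 2 → DerZ (A k)) (E : Fin 2 → DerZ (L k)),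
      (∀ α a, algebraMap (A k) (L k) (D α a) = E α (algebraMap (A k) (L k) a)) ∧
        ∀ α β, E α = E β + thetaFamily k α β := by
  rintro ⟨D, E, hDE, hθ⟩
  exact not_exists_isAtlasLift_doubledLine k
    (exists_isAtlasLift_twisted_of_ksCoboundary (res k) (res k) (idealZ k) (idealZ₂ k) (thetaFamily k)
      (preservesLifts_res k) (preservesLifts_res k) D (fun α _ ↦ E α) (fun _ β ↦ E β)
      (fun α _ a ↦ hDE α a) (fun _ β a ↦ hDE β a) hθ)

/-- **The smoothing direction of the `A₁`-singularity is non-trivial on the `(−2)`-bundle**: there are no chart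
vector fields `D₀` on `k[s,p]`, `D₁` on `k[t,q]`, extending along the chart maps `resM2` to `E₀, E₁` on
`k[s,s⁻¹,p]`, with `E_α = E_β + θ_αβ` — else the zero section would lift, contradicting
`not_exists_isAtlasLift_minusTwo`. [cite: Hartshorne2010, §5 Ex. 5.2 / §6 Thm. 6.2 (b)] -/
theorem thetaFamily_not_ksCoboundary_minusTwo :
    ¬ ∃ (D : Fin 2 → DerZ (A k)) (E : Fin 2 → DerZ (L k)),
      (∀ α a, resM2 k α (D α a) = E α (resM2 k α a)) ∧ ∀ α β, E α = E β + thetaFamily k α β := by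
  rintro ⟨D, E, hDE, hθ⟩
  exact not_exists_isAtlasLift_minusTwo k
    (exists_isAtlasLift_twisted_of_ksCoboundary (fun α _ ↦ resM2 k α) (fun _ β ↦ resM2 k β) (idealZ k)
      (idealZ₂ k) (thetaFamily k) (preservesLifts_resM2 k) (fun α β ↦ preservesLifts_resM2 k β α) D
      (fun α _ ↦ E α) (fun _ β ↦ E β) (fun α _ a ↦ hDE α a) (fun _ β a ↦ hDE β a) hθ)

omit [Nontrivial k] in
/-- **Positive companion for the `(−2)`-bundle atlas**: with the TRIVIAL direction (`θ = 0`, the product deformation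
`X × D`) the zero section DOES lift (`exists_isAtlasLift_twisted_of_ksCoboundary` with all vector fields `0`).  So on
the separated atlas too the pair (`θ = 0` lifts / `θ = s⁻¹∂_p` does not) is a clean zero / non-zero dichotomy.
[cite: Hartshorne2010, §6 Thm. 6.2 (b)] -/
theorem exists_isAtlasLift_minusTwo_untwisted :
    ∃ K : Fin 2 → Ideal (A k)[ε],
      IsAtlasLift (fun _ : Fin 2 ↦ fstRingHom (A k)) (fun _ ↦ (ε : (A k)[ε])) (fun α _ ↦ mapRingHom (resM2 k α))
        (fun α β ↦ (twist ((fun _ _ ↦ (0 : DerZ (L k))) α β) : (L k)[ε] →+* (L k)[ε]).comp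
          (mapRingHom (resM2 k β)))
        (idealZ k) K :=
  exists_isAtlasLift_twisted_of_ksCoboundary (fun α _ ↦ resM2 k α) (fun _ β ↦ resM2 k β) (idealZ k) (idealZ₂ k)
    (fun _ _ ↦ 0) (preservesLifts_resM2 k) (fun α β ↦ preservesLifts_resM2 k β α) (fun _ ↦ 0) (fun _ _ ↦ 0)
    (fun _ _ ↦ 0) (fun _ _ a ↦ by simp) (fun _ _ a ↦ by simp) (fun _ _ ↦ by simp)

end DoubledLine

end EmbeddedDeformation

end Summit.Ventures.HSemireg
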